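import Literature.AnabelianGeometry.EtaleTheta.ArithThetaTowerPrelim
import Literature.AnabelianGeometry.EtaleTheta.ArithThetaTowerPerfFactorialProducts
import Literature.AnabelianGeometry.EtaleTheta.DivisorMonoidsOfGaloisCovering
import Literature.AlgebraicGeometry.Frobenioids.PadicFrobenioidConstantMonoid
import Literature.IUT.HodgeTheaters.BadLocalFrobenioidBases
import Literature.IUT.HodgeTheaters.GaloisCosetFields
import HarnessLib

/-!
# [EtTh] Prop. 3.4 (i) (weak, with cofinal perfection) for the GA-02 carrier «constants × geometry»: `Φ₀` of
# `(DivisorMonoids.ofPadicBase F).prod ((DivisorMonoids.ofGaloisAction A hZ).precomp E)` is perf-factorial — the `hpf`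
# input of `ArithThetaTower.realified` (GAP A, row D3 / item GA-03), stated over the LANDED plumbing of GA-02 (p666726)

Mochizuki, *The étale theta function and its Frobenioid-theoretic manifestations*, Publ. RIMS **45** (2009), §3:
Def. 3.3 (iii) PDF p. 73, Prop. 3.4 (i) p. 74 ("`Φ₀(Y^log)` … is perf-factorial"), Def. 3.6 (i) p. 76 (`Φ₀^ℝ := Φ₀^rlf`)
[cite: MochizukiEtTh2009, Prop 3.4 p.74]; Mochizuki, *The geometry of Frobenioids II*, Kyushu J. Math. **62** (2008),
Ex. 1.1 (i) p. 7 («`Spec(K) ↦ ord(O_K^⊳)` … `≅ ℤ≥0`») [cite: MochizukiFrdII2008, Ex 1.1 (i) p.7]; Mochizuki,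
*Inter-universal Teichmüller theory I*, Ex. 3.2 (i)–(ii) p. 70 (`𝒟_v = 𝓑^temp(X̲̲_v)⁰ → 𝒟⊢_v`, the base of `ℱ̲_v`)
[cite: Mochizuki2012, I Ex 3.2 (ii) p.70].

abc-iut cell, GAP A (G-L5-EX32I-1), item **GA-03** (seat abc-iut-gapA-03-realified; memo GAP-SIZING-A §2 row D3; ruled shape
`plan/L5/GAP-A-SIGNATURES.md` v1 §3).  GA-02 (RULINGS #334/#338, board «GA-02 FILED 1/3 p666726») assembles the divisor monoid
of the arithmetic theta tower as the PRODUCT (`DivisorMonoids.prod`, `ArithThetaTowerPrelim.lean`) of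
* the Def. 3.3 (iii) data of GENUINE CONSTANTS `DivisorMonoids.ofPadicBase (T.proj ⋙ d.fieldFunctor)` — `Φ₀(U) =
  ord(𝒪^▷_{Ω^{aug U}})`, the value monoid of the `p`-adic local field `Ω^{aug U}` ([FrdII] Ex. 1.1 (i);
  `GaloisValDatum.fieldFunctor_isPadicLocal`), and
* the GEOMETRIC data `(DivisorMonoids.ofGaloisAction A hZ).precomp (ArithThetaTower.cosetGSetFunctor P)` — `Φ₀(U) =
  A.phiZero (P/U) = Hom_P(P/U, Div⁺(Z^log_∞))` of a Galois-action record `A` (abc-iut-w6-d058), restricted to the slot's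
  small base `T.Dv = CosetCat P` —
so that `Φ₀(U) = ord(𝒪^▷_{Ω^{aug U}}) × A.phiZero (P/U)` by `rfl` (constants first).  THIS PROOF-ONLY FILE (theorems only)
discharges [EtTh] Prop. 3.4 (i) in the cell's weak vocabulary of record — the hypothesis
`hpf : ∀ Y, IsPerfFactorialCof (Φ₀ Y)` of `RealifiedDivisorMonoids.ofRlfZWeak` (Def. 3.6 (i)) — for EVERY carrier of
this shape, generically in the field functor `F` (landing in `p`-adic LOCAL fields), the Galois-action record `A` and the
base-change functor `E`:

* `DivisorMonoids.isZMonoprime_ofPadicBase_Φ₀` / `isPerfFactorialCof_ofPadicBase_Φ₀` — the constants' `Φ₀(A) =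
  ord(𝒪^▷_{L_A}) ≅ ℤ≥0` (`PadicFld.IsPadicLocal.isZMonoprime_ordInt`), hence weakly perf-factorial with cofinal perfection;
* **`DivisorMonoids.isPerfFactorialCof_ofPadicBase_prod_Φ₀`** — `ord(𝒪^▷_{L_A}) × A.phiZero (E A)` is weakly
  perf-factorial with cofinal perfection (this seat's product lemma `LogDivisorModel.GaloisAction.isPerfFactorialCof_prod_phiZero`,
  `ArithThetaTowerPerfFactorialProducts.lean` p667541: both factors have charts into `∏ ℤ≥0` with group-saturated
  perf-dense image, and charts multiply), with `ℤ`-monoprime prime components (Rmk. 3.3.1) and the symmetric order;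
* **`ArithThetaTower.isPerfFactorial_constProdGeom d T A hZ`** — the instance at the slot: `F := T.proj ⋙ d.fieldFunctor`
  (`Ω^{aug U}` is `p`-adic local for every `U`), `E := cosetGSetFunctor P`; i.e. the `hpf` of GA-02's announced
  `divisorMonoidsOf d T A hZ` ON THE NOSE, for every Galois-action record `A` (in particular the theta envelope's).
The two RULED declarations `ArithThetaTower.isPerfFactorial_divisorMonoids` / `ArithThetaTower.realified` (file
`ArithThetaTowerRealified.lean`) instantiate these at GA-02's named terms `divisorMonoidsOf` / `divisorMonoids` once landed.

HONEST FRAMING: lemmas over the tree's typed interfaces (`PadicFld`, `GaloisValDatum`, `BadLocalGroupDatum`,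
`LogDivisorModel.GaloisAction` — interface records; nothing asserts they arise from an actual curve); "perf-factorial" READ
weakly (`IsPerfFactorialCof`, F-L2d2-1/F-L2d2-2); an UNDISPUTED construction step around [IUTchIII] Cor. 3.12, on which NO
side is taken (D-0045); COUNT-NEUTRAL; typed ≠ inhabited ≠ proved-in-print; nothing here asserts the abc conjecture proved
or refuted.
-/

noncomputable section

namespace Literature.AnabelianGeometry.EtaleTheta

open CategoryTheory Opposite Literature.AlgebraicGeometry.Frobenioids Literature.AlgebraicGeometry.Frobenioids.PadicFrd
  Literature.IUT.HodgeTheaters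

universe u v

/-! ### Generic: constants along a field functor, alone and times a geometric `Φ₀`-piece -/

namespace DivisorMonoids

variable {p : ℕ} [Fact p.Prime] {D : Type u} [Category.{v} D] (F : D ⥤ PadicFld.{0} p)
  (hF : ∀ X : D, (F.obj X).IsPadicLocal)

include hF

/-- **`Φ₀(A) = ord(𝒪^▷_{L_A})` of the constants data is `ℤ`-monoprime** (`≅ ℤ≥0`) when `L_A` is a `p`-adic local field
([FrdII] Ex. 1.1 (i); abc-iut-L1's `PadicFld.IsPadicLocal.isZMonoprime_ordInt`). [cite: MochizukiFrdII2008, Ex 1.1 (i) p.7] -/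
theorem isZMonoprime_ofPadicBase_Φ₀ (Y : Dᵒᵖ) : IsZMonoprime ((ofPadicBase F).Φ₀.obj Y) :=
  (hF Y.unop).isZMonoprime_ordInt

/-- Hence `Φ₀(A) = ord(𝒪^▷_{L_A})` of the constants data is weakly perf-factorial with cofinal perfection (a chart onto
`∏_{pt} ℤ≥0`). [cite: MochizukiEtTh2009, Prop 3.4 p.74] -/
theorem isPerfFactorialCof_ofPadicBase_Φ₀ (Y : Dᵒᵖ) : IsPerfFactorialCof ((ofPadicBase F).Φ₀.obj Y) :=
  IsPerfFactorialCof.of_exists_piNatChart (exists_piNatChart_of_isZMonoprime (isZMonoprime_ofPadicBase_Φ₀ F hF Y))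

/-- Prop. 3.4 (i), first clause, in the weak vocabulary of record, for the constants data. [cite: MochizukiEtTh2009, Prop 3.4 p.74] -/
theorem prop34_i_ofPadicBase_Φ₀ (Y : Dᵒᵖ) : treeMonoidVocabWeak.IsPerfFactorial ((ofPadicBase F).Φ₀.obj Y) :=
  (treeMonoidVocabWeak_isPerfFactorial _).mpr (isPerfFactorialCof_ofPadicBase_Φ₀ F hF Y)

section WithGeometry

variable {Z : LogDivisorModel.{0}} {G : Type} [Group G] (A : Z.GaloisAction G) (hZ : Z.CuspLaws)
  (E : D ⥤ Action (Type 0) G)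

/-- **[EtTh] Prop. 3.4 (i) (weak, cofinal) for `Φ₀ = ord(𝒪^▷_{L_A}) × A.phiZero (E A)`** — the `Φ₀` of the product of the
constants data along `F` with the geometric Def. 3.3 (iii) data of a Galois-action record `A` pulled back along `E`: both
factors have charts into `∏ ℤ≥0` with group-saturated, perf-dense image (the constants' `≅ ℤ≥0`; the geometric one by
abc-iut-w6-d057's route, Rmk. 3.3.1), and charts multiply (`isPerfFactorialCof_prod_phiZero`).
[cite: MochizukiEtTh2009, Prop 3.4 p.74] -/
theorem isPerfFactorialCof_ofPadicBase_prod_Φ₀ (Y : Dᵒᵖ) :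
    IsPerfFactorialCof (((ofPadicBase F).prod ((ofGaloisAction A hZ).precomp E)).Φ₀.obj Y) :=
  LogDivisorModel.GaloisAction.isPerfFactorialCof_prod_phiZero A (E.obj Y.unop) (isZMonoprime_ofPadicBase_Φ₀ F hF Y)

/-- The same with the geometric factor first: `Φ₀ = A.phiZero (E A) × ord(𝒪^▷_{L_A})`. [cite: MochizukiEtTh2009, Prop 3.4 p.74] -/
theorem isPerfFactorialCof_prod_ofPadicBase_Φ₀ (Y : Dᵒᵖ) :
    IsPerfFactorialCof ((((ofGaloisAction A hZ).precomp E).prod (ofPadicBase F)).Φ₀.obj Y) :=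
  LogDivisorModel.GaloisAction.isPerfFactorialCof_phiZero_prod A (E.obj Y.unop) (isZMonoprime_ofPadicBase_Φ₀ F hF Y)

/-- Every prime component of `ord(𝒪^▷_{L_A}) × A.phiZero (E A)` is `ℤ`-monoprime (Rmk. 3.3.1: the one prime of the value
monoid, and the `G`-orbits of prime log-divisors). [cite: MochizukiEtTh2009, Rmk 3.3.1 p.73] -/
theorem isZMonoprime_submonoid_primes_ofPadicBase_prod_Φ₀ (Y : Dᵒᵖ)
    (𝔭 : Primes (((ofPadicBase F).prod ((ofGaloisAction A hZ).precomp E)).Φ₀.obj Y)) : IsZMonoprime ↥𝔭.submonoid :=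
  isZMonoprime_submonoid_primes_of_exists_piNatChart
    (exists_piNatChart_prod (exists_piNatChart_of_isZMonoprime (isZMonoprime_ofPadicBase_Φ₀ F hF Y))
      (LogDivisorModel.GaloisAction.exists_piNatChart_phiZero A (E.obj Y.unop))) 𝔭

/-- Prop. 3.4 (i), first clause, in the weak vocabulary of record (`treeMonoidVocabWeak.IsPerfFactorial = IsPerfFactorialCof`)
for `ord(𝒪^▷_{L_A}) × A.phiZero (E A)`. [cite: MochizukiEtTh2009, Prop 3.4 p.74] -/
theorem prop34_i_ofPadicBase_prod_Φ₀ (Y : Dᵒᵖ) :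
    treeMonoidVocabWeak.IsPerfFactorial (((ofPadicBase F).prod ((ofGaloisAction A hZ).precomp E)).Φ₀.obj Y) :=
  (treeMonoidVocabWeak_isPerfFactorial _).mpr (isPerfFactorialCof_ofPadicBase_prod_Φ₀ F hF A hZ E Y)

end WithGeometry

end DivisorMonoids

/-! ### At the slot: `F := T.proj ⋙ d.fieldFunctor`, `E := cosetGSetFunctor P` (GA-02's announced carrier) -/

namespace ArithThetaTower

variable {p : ℕ} [Fact p.Prime] (d : GaloisValDatum.{0} p) {P : Type} [Group P] [TopologicalSpace P]
  (T : BadLocalGroupDatum d.Gal P)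

/-- Every `Ω^{aug U}`, `U ∈ Ob(𝒟_v)`, is a `p`-adic local field (`GaloisValDatum.fieldFunctor_isPadicLocal` through
`T.proj : 𝒟_v → 𝒟⊢_v`). [cite: Mochizuki2012, I Ex 3.2 (i) p.70] -/
theorem isPadicLocal_proj_fieldFunctor (U : T.Dv) : ((T.proj ⋙ d.fieldFunctor).obj U).IsPadicLocal :=
  d.fieldFunctor_isPadicLocal (T.proj.obj U)

/-- `ord(𝒪^▷_{Ω^{aug U}})` — the constants' `Φ₀` at `U` — is `ℤ`-monoprime. [cite: MochizukiFrdII2008, Ex 1.1 (i) p.7] -/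
theorem isZMonoprime_constΦ₀ (Y : (T.Dv)ᵒᵖ) :
    IsZMonoprime ((DivisorMonoids.ofPadicBase (T.proj ⋙ d.fieldFunctor)).Φ₀.obj Y) :=
  DivisorMonoids.isZMonoprime_ofPadicBase_Φ₀ _ (isPadicLocal_proj_fieldFunctor d T) Y

variable {Z : LogDivisorModel.{0}} (A : Z.GaloisAction P) (hZ : Z.CuspLaws)

/-- **[EtTh] Prop. 3.4 (i) (weak, cofinal) for the GA-02 carrier of the arithmetic theta tower** — `Φ₀(U) =
ord(𝒪^▷_{Ω^{aug U}}) × A.phiZero (P/U)` for every `U ∈ Ob(𝒟_v) = CosetCat P` and every Galois-action record `A` on `P`: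
the `hpf` hypothesis of `RealifiedDivisorMonoids.ofRlfZWeak` at
`(ofPadicBase (T.proj ⋙ d.fieldFunctor)).prod ((ofGaloisAction A hZ).precomp (cosetGSetFunctor P))`.
[cite: MochizukiEtTh2009, Prop 3.4 p.74] -/
theorem isPerfFactorial_constProdGeom : ∀ Y : (T.Dv)ᵒᵖ,
    IsPerfFactorialCof (((DivisorMonoids.ofPadicBase (T.proj ⋙ d.fieldFunctor)).prod
      ((DivisorMonoids.ofGaloisAction A hZ).precomp (cosetGSetFunctor P))).Φ₀.obj Y) := fun Y =>
  DivisorMonoids.isPerfFactorialCof_ofPadicBase_prod_Φ₀ _ (isPadicLocal_proj_fieldFunctor d T) A hZ _ Y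

/-- Every prime component of `Φ₀(U) = ord(𝒪^▷_{Ω^{aug U}}) × A.phiZero (P/U)` is `ℤ`-monoprime (Rmk. 3.3.1).
[cite: MochizukiEtTh2009, Rmk 3.3.1 p.73] -/
theorem isZMonoprime_submonoid_primes_constProdGeom (Y : (T.Dv)ᵒᵖ)
    (𝔭 : Primes (((DivisorMonoids.ofPadicBase (T.proj ⋙ d.fieldFunctor)).prod
      ((DivisorMonoids.ofGaloisAction A hZ).precomp (cosetGSetFunctor P))).Φ₀.obj Y)) : IsZMonoprime ↥𝔭.submonoid :=
  DivisorMonoids.isZMonoprime_submonoid_primes_ofPadicBase_prod_Φ₀ _ (isPadicLocal_proj_fieldFunctor d T) A hZ _ Y 𝔭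

/-- Prop. 3.4 (i), first clause, in the weak vocabulary of record, for the GA-02 carrier. [cite: MochizukiEtTh2009, Prop 3.4 p.74] -/
theorem prop34_i_constProdGeom (Y : (T.Dv)ᵒᵖ) :
    treeMonoidVocabWeak.IsPerfFactorial (((DivisorMonoids.ofPadicBase (T.proj ⋙ d.fieldFunctor)).prod
      ((DivisorMonoids.ofGaloisAction A hZ).precomp (cosetGSetFunctor P))).Φ₀.obj Y) :=
  (treeMonoidVocabWeak_isPerfFactorial _).mpr (isPerfFactorial_constProdGeom d T A hZ Y)

end ArithThetaTower

end Literature.AnabelianGeometry.EtaleTheta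

end
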